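import Summits.AtomisticToContinuum.BoseEinsteinCondensation.Theorems.BECGroundStateSOSPeriodicIRBoundFsumDefs
import Summits.AtomisticToContinuum.BoseEinsteinCondensation.Theorems.BECGroundStateSOSPeriodicIRBoundFsumDCKinetic
import Summits.AtomisticToContinuum.BoseEinsteinCondensation.Theorems.BECConjugateDominationIMUChainGlueEnergy
import Literature.MathematicalPhysics.QuantumManyBody.PeriodicClusteringFromKyFanGap
import HarnessLib

/-!
# Crux `PeriodicIRBound` (stmt-AtomisticToContinuum-3972), line `fsum-phase-pencil`, stub S5-A
# `stub_fsumBootstrapAssembly` — the normalisation bootstrap assembled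

`NormalisationBootstrap` (no-cat `CondensateNumberVarianceClass` + the `n₀`-weighted infrared bound
`WeightedClassBound` ⇒ `IRBoundFor w` for every `w` of the class `𝒱(R₀, V₁)`) from three inputs taken as
HYPOTHESES (registered neighbour stubs of the line):

* (M) the moment inequality `N n_k − ⟨n_k n₀⟩ ≤ (N/2) n_k + N · Var(n₀)/(n̄₀ − N/2)` for `n̄₀ > N/2`;
* (D) the condensate dichotomy `n̄₀ ≤ 3N/20 ∨ 17N/20 ≤ n̄₀` for near-minimisers of every class potential;
* (C) coupling continuity at fixed `(N, L)`: a dichotomy holding for the near-minimisers of every `t·w`,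
  `t ∈ [0, 1]`, selects the condensed branch at `t = 1`.

Assembly at fixed `(N, L_N)`, `N = n + 2`, slack `δ = min(δ_c, δ_v, δ_W)` (condensation, no-cat, least window
slack over the finite box `inWindow_mem_box`): kinematics `⟨n_k n₀⟩ ≤ ‖T_{k0}Ψ‖² ≤ ½(‖U_kΨ‖² + ‖P_kΨ‖²)`
(`‖a†Φ‖² = ‖Φ‖² + ‖aΦ‖²`, parallelogram law) `≤ ½ C N√ρ L/‖k‖_∞`, no-cat `Var(n₀) ≤ C_V N` and condensation
`n̄₀ ≥ 17N/20` in (M) give `n_k ≤ C√ρL/‖k‖_∞ + (40/7) C_V ≤ (C + 6 C_V κ) √ρ L/‖k‖_∞` on the window.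
-/

noncomputable section

open MeasureTheory Filter
open scoped ENNReal NNReal ComplexConjugate BigOperators

namespace Summit.AtomisticToContinuum.BoseEinsteinCondensation.Cruxes.PeriodicIRBound.FsumPhasePencil

open Literature.MathematicalPhysics.QuantumManyBody.BoseGas
open Summit.AtomisticToContinuum.BoseEinsteinCondensation.Theorems.PeriodicIRBound.Negative
  (NearMin InWindow IRBoundFor IRIneq irIneq_iff inWindow_mem_box)
open Summit.AtomisticToContinuum.BoseEinsteinCondensation.Theorems.GaussianDominationCan.Negative (one_le_norm_intVec)
open Summit.AtomisticToContinuum.BoseEinsteinCondensation.Theorems.IMUChainGlue (periodicGroundStateEnergy_le_pairs)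
open Summit.AtomisticToContinuum.BoseEinsteinCondensation.Cruxes.PeriodicIRBound.LinearPhFloorWagner.WF

variable {n : ℕ} {L : ℝ}

/-! ## Real bookkeeping -/

/-- Real bookkeeping of the bootstrap at fixed `(N, L, k, Ψ)`: condensation `x ≥ 17N/20`, no-cat
`x + S₀ ≤ x² + C_V N`, the kinematic/weighted bound `2(x + m) ≤ U + P ≤ C N s L/‖k‖_∞`, the moment inequality
and the window `1 ≤ ‖k‖_∞ ≤ κ s L` give `n_k ≤ (C + 6 C_V κ) s L/‖k‖_∞`. [folklore] -/
theorem bootstrap_algebra {N x S₀ m nk UP C CV κ s L kinf : ℝ} (hN : 0 < N) (hCV : 0 < CV)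
    (hκ : 0 < κ) (hs : 0 < s) (hL : 0 < L) (hkinf : 1 ≤ kinf) (hwin : kinf ≤ κ * s * L)
    (hx : 17 / 20 * N ≤ x) (hvar : x + S₀ ≤ x ^ 2 + CV * N) (hpar : 2 * (x + m) ≤ UP)
    (hWB : UP ≤ C * N * s * L / kinf)
    (hM : N * nk - m ≤ N / 2 * nk + N * (S₀ + x - x ^ 2) / (x - N / 2)) :
    nk ≤ (C + 6 * CV * κ) * s * L / kinf := by
  have hkpos : 0 < kinf := by linarith
  have hd : 7 / 20 * N ≤ x - N / 2 := by linarith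
  have hdpos : 0 < x - N / 2 := by linarith
  have hV : S₀ + x - x ^ 2 ≤ CV * N := by linarith
  have h1 : N * (S₀ + x - x ^ 2) / (x - N / 2) ≤ N * (CV * N) / (x - N / 2) :=
    div_le_div_of_nonneg_right (mul_le_mul_of_nonneg_left hV hN.le) hdpos.le
  have h2 : N * (CV * N) / (x - N / 2) ≤ N * (CV * N) / (7 / 20 * N) :=
    div_le_div_of_nonneg_left (by positivity) (by positivity) hd
  have h3 : N * (CV * N) / (7 / 20 * N) = 20 / 7 * CV * N := by
    field_simp
  have hm : N / 2 * nk ≤ m + 20 / 7 * CV * N := by linarith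
  have hUP : UP * kinf ≤ C * N * s * L := (le_div_iff₀ hkpos).1 hWB
  have hx0 : 0 ≤ x := by linarith
  have h4 : N / 2 * (nk * kinf) ≤ C * N * s * L / 2 + 20 / 7 * CV * N * (κ * s * L) := by
    have h5 := mul_le_mul_of_nonneg_right hm hkpos.le
    have h6 : m * kinf ≤ UP / 2 * kinf := mul_le_mul_of_nonneg_right (by linarith) hkpos.le
    have h7 : 20 / 7 * CV * N * kinf ≤ 20 / 7 * CV * N * (κ * s * L) :=
      mul_le_mul_of_nonneg_left hwin (by positivity)
    nlinarith
  have h8 : nk * kinf ≤ C * s * L + 40 / 7 * CV * (κ * s * L) := by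
    refine le_of_mul_le_mul_left ?_ (half_pos hN)
    calc N / 2 * (nk * kinf) ≤ C * N * s * L / 2 + 20 / 7 * CV * N * (κ * s * L) := h4
      _ = N / 2 * (C * s * L + 40 / 7 * CV * (κ * s * L)) := by ring
  have h9 : 0 < CV * (κ * s * L) := by positivity
  rw [le_div_iff₀ hkpos]
  nlinarith

/-! ## The class is closed under couplings; `E₀ < ∞` on the class; kinematics -/

/-- The class `𝒱(R₀, V₁)` is closed under couplings `t ∈ [0, 1]`: `t·w ∈ 𝒱(R₀, V₁)`. [folklore] -/
theorem inClass_coupling {R₀ V₁ : ℝ} {w : ℝ → ℝ≥0∞} (hw : InClass R₀ V₁ w) {t : ℝ}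
    (ht : t ∈ Set.Icc (0 : ℝ) 1) : InClass R₀ V₁ (fun r => ENNReal.ofReal t * w r) := by
  refine ⟨hw.1.const_mul _, fun r hr => by simp only [hw.2.1 r hr, mul_zero], ?_⟩
  calc (∫⁻ x : Space, ENNReal.ofReal t * w ‖x‖) = ENNReal.ofReal t * ∫⁻ x : Space, w ‖x‖ :=
        lintegral_const_mul' _ _ ENNReal.ofReal_ne_top
    _ ≤ 1 * ∫⁻ x : Space, w ‖x‖ := by gcongr; exact ENNReal.ofReal_le_one.2 ht.2
    _ ≤ ENNReal.ofReal V₁ := by rw [one_mul]; exact hw.2.2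

/-- `E₀^per(n+2, L) < ∞` for a class potential (Hartree bound by the constant trial state,
`periodicGroundStateEnergy_le_pairs`). [folklore] -/
theorem periodicGroundStateEnergy_ne_top_of_inClass {R₀ V₁ : ℝ} {w : ℝ → ℝ≥0∞} (hw : InClass R₀ V₁ w)
    (n : ℕ) (hL : 0 < L) : periodicGroundStateEnergy w (n + 2) L ≠ ⊤ := by
  refine ne_top_of_le_ne_top ?_ (periodicGroundStateEnergy_le_pairs hL hw.1 n)
  refine ENNReal.mul_ne_top (ENNReal.natCast_ne_top _) (ENNReal.mul_ne_top ?_ ?_)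
  · exact ENNReal.inv_ne_top.2 (pow_ne_zero _ (ENNReal.ofReal_pos.2 hL).ne')
  · exact ne_top_of_le_ne_top ENNReal.ofReal_ne_top hw.2.2

/-- Kinematics `2‖T_{k0}Ψ‖² ≤ ‖U_kΨ‖² + ‖P_kΨ‖²` for a continuous `(n+1)`-body `Ψ` (parallelogram law for
`U_k = T_{k0} − T_{0,−k}`, `P_k = T_{k0} + T_{0,−k}`, dropping `2‖T_{0,−k}Ψ‖² ≥ 0`). [folklore] -/
theorem two_mul_toReal_normSq_transfer_le (k : Fin 3 → ℤ) {Ψ : Config (n + 1) → ℂ} (hΨ : Continuous Ψ) :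
    2 * (normSq L (transfer L k 0 Ψ)).toReal ≤
      (normSq L (phaseUp L k Ψ)).toReal + (normSq L (condUp L k Ψ)).toReal := by
  have h1 := continuous_transfer L k 0 hΨ
  have h2 := continuous_transfer L 0 (-k) hΨ
  have hpar : normSq L (condUp L k Ψ) + normSq L (phaseUp L k Ψ) =
      2 * normSq L (transfer L k 0 Ψ) + 2 * normSq L (transfer L 0 (-k) Ψ) :=
    lintegral_cellN_sq_add_add_sub L h1 h2
  have hP : normSq L (condUp L k Ψ) ≠ ⊤ := normSq_ne_top L (show Continuous (condUp L k Ψ) from h1.add h2)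
  have hU : normSq L (phaseUp L k Ψ) ≠ ⊤ := normSq_ne_top L (continuous_phaseUp L k hΨ)
  have hT1 : normSq L (transfer L k 0 Ψ) ≠ ⊤ := normSq_ne_top L h1
  have hT2 : normSq L (transfer L 0 (-k) Ψ) ≠ ⊤ := normSq_ne_top L h2
  have h := congrArg ENNReal.toReal hpar
  rw [ENNReal.toReal_add hP hU, ENNReal.toReal_add (ENNReal.mul_ne_top ENNReal.ofNat_ne_top hT1)
    (ENNReal.mul_ne_top ENNReal.ofNat_ne_top hT2), ENNReal.toReal_mul, ENNReal.toReal_mul,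
    ENNReal.toReal_ofNat] at h
  have h0 : 0 ≤ (normSq L (transfer L 0 (-k) Ψ)).toReal := ENNReal.toReal_nonneg
  linarith

/-- Monotonicity of the near-minimiser property in the slack (local copy). [folklore] -/
private theorem nearMin_weaken {N : ℕ} {w : ℝ → ℝ≥0∞} {ρ : ℝ} {δ δ' : ℝ≥0∞}
    {Ψ : PeriodicTrialState N (sideLength ρ N)} (h : NearMin w ρ N δ Ψ) (hδ : δ ≤ δ') : NearMin w ρ N δ' Ψ :=
  le_trans (show periodicEnergy w Ψ ≤ _ from h) (add_le_add le_rfl hδ)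

/-! ## The estimate at fixed `(N, L, k, Ψ)` -/

/-- **The bootstrap at fixed `(N, L, k, Ψ)`, `N = n + 2`.** From the moment inequality (M), condensation
`17N/20 ≤ n̄₀(Ψ)`, no-cat `‖n̂₀Ψ‖² ≤ ⟨Ψ, n̂₀Ψ⟩² + C_V N` and the weighted bound
`‖U_kΨ‖² + ‖P_kΨ‖² ≤ C N s L/‖k‖_∞` at a mode `k ≠ 0` with `‖k‖_∞ ≤ κ s L`:
`n_k(Ψ) ≤ (C + 6 C_V κ) s L/‖k‖_∞` (in `ℝ≥0∞`, `n_k = cellOccupation`). Identifications: `n̄₀ = ‖a₀Ψ‖²`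
(`normSq_modeAn`, `cellOccupation_planeWaveMode_zero`), `⟨Ψ, n̂₀Ψ⟩ = ‖a₀Ψ‖²`, `‖T_{ab}Ψ‖² = ‖a_bΨ‖² + ‖a_aa_bΨ‖²`,
`2‖T_{k0}Ψ‖² ≤ ‖U_kΨ‖² + ‖P_kΨ‖²`; then `bootstrap_algebra`. [folklore] -/
theorem cellOccupation_le_of_bootstrap_inputs
    (hM : ∀ {n : ℕ} {L : ℝ}, 0 < L → ∀ {k : Fin 3 → ℤ}, k ≠ 0 → ∀ (Ψ : PeriodicTrialState (n + 2) L),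
      (n + 2 : ℝ) / 2 < (normSq L (modeAn L (planeWaveMode L 0) Ψ.ψ)).toReal →
        (n + 2 : ℝ) * (normSq L (modeAn L (planeWaveMode L k) Ψ.ψ)).toReal -
            (normSq L (modeAn L (planeWaveMode L k) (modeAn L (planeWaveMode L 0) Ψ.ψ))).toReal ≤
          (n + 2 : ℝ) / 2 * (normSq L (modeAn L (planeWaveMode L k) Ψ.ψ)).toReal +
            (n + 2 : ℝ) * ((normSq L (modeAn L (planeWaveMode L 0) (modeAn L (planeWaveMode L 0) Ψ.ψ))).toReal +
              (normSq L (modeAn L (planeWaveMode L 0) Ψ.ψ)).toReal -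
                (normSq L (modeAn L (planeWaveMode L 0) Ψ.ψ)).toReal ^ 2) /
              ((normSq L (modeAn L (planeWaveMode L 0) Ψ.ψ)).toReal - (n + 2 : ℝ) / 2))
    (hL : 0 < L) {k : Fin 3 → ℤ} (hk : k ≠ 0) (Ψ : PeriodicTrialState (n + 2) L) {C CV κ s : ℝ}
    (hCV : 0 < CV) (hκ : 0 < κ) (hs : 0 < s) (hCpos : 0 < C + 6 * CV * κ)
    (hwin : ‖(fun j => (k j : ℝ))‖ ≤ κ * s * L)
    (hcond : 17 / 20 * ((n + 2 : ℕ) : ℝ) ≤ (condensateOccupation (n + 2) L Ψ.ψ).toReal)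
    (hvar : (normSq L (transfer L 0 0 Ψ.ψ)).toReal ≤
      innerRe L Ψ.ψ (transfer L 0 0 Ψ.ψ) ^ 2 + CV * ((n + 2 : ℕ) : ℝ))
    (hWB : (normSq L (phaseUp L k Ψ.ψ)).toReal + (normSq L (condUp L k Ψ.ψ)).toReal ≤
      C * ((n + 2 : ℕ) : ℝ) * s * L / ‖(fun j => (k j : ℝ))‖) :
    cellOccupation (n + 2) L (planeWaveMode L k) Ψ.ψ ≤
      ENNReal.ofReal ((C + 6 * CV * κ) * s * L / ‖(fun j => (k j : ℝ))‖) := by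
  have hcore : IsCore L Ψ.ψ := isCore_trialState Ψ
  have hΨc : Continuous Ψ.ψ := Ψ.contDiff.continuous
  have ha0c : Continuous (modeAn L (planeWaveMode L 0) Ψ.ψ) :=
    continuous_modeAn L (continuous_planeWaveMode L 0) hΨc
  have hakc : Continuous (modeAn L (planeWaveMode L k) Ψ.ψ) :=
    continuous_modeAn L (continuous_planeWaveMode L k) hΨc
  have hkinf : 1 ≤ ‖(fun j => (k j : ℝ))‖ := one_le_norm_intVec hk
  -- `n̄₀ = ‖a₀Ψ‖²`
  have hx_eq : condensateOccupation (n + 2) L Ψ.ψ = normSq L (modeAn L (planeWaveMode L 0) Ψ.ψ) := by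
    rw [normSq_modeAn hL 0 Ψ.ψ, cellOccupation_planeWaveMode_zero]
  -- `⟨Ψ, n̂₀Ψ⟩ = ‖a₀Ψ‖²`
  have hinner : innerRe L Ψ.ψ (transfer L 0 0 Ψ.ψ) = (normSq L (modeAn L (planeWaveMode L 0) Ψ.ψ)).toReal := by
    rw [← innerRe_modeAn_modeAn 0 0 hΨc hcore.symm hΨc, innerRe_self ha0c]
  have hT00 := toReal_normSq_transfer hL 0 0 hcore
  have hTk0 := toReal_normSq_transfer hL k 0 hcore
  have hpar := two_mul_toReal_normSq_transfer_le (L := L) k hΨc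
  rw [hx_eq] at hcond
  rw [hT00, hinner] at hvar
  rw [hTk0] at hpar
  push_cast at hcond hvar hWB
  have hN : (0 : ℝ) < n + 2 := by positivity
  have hgt : (n + 2 : ℝ) / 2 < (normSq L (modeAn L (planeWaveMode L 0) Ψ.ψ)).toReal := by linarith
  have hMk := hM hL hk Ψ hgt
  rw [← normSq_modeAn hL k Ψ.ψ, ENNReal.le_ofReal_iff_toReal_le (normSq_ne_top L hakc) (by positivity)]
  exact bootstrap_algebra hN hCV hκ hs hL hkinf hwin hcond hvar (by linarith) hWB hMk

/-! ## The normalisation bootstrap -/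

/-- **The normalisation bootstrap `NormalisationBootstrap` from (M), (D), (C).** For a class `𝒱(R₀, V₁)` with
no-cat constants `(ρ_v, C_V)`, weighted-bound constants `(ρ_w, C)` at the window `κ` and dichotomy density `ρ₁`:
`ρ₀ = min(ρ_v, ρ_w, ρ₁)`, constant `C + 6 C_V κ`; eventually in `N = n + 2`: condensation of the
`δ_c`-near-minimisers of `w` by (C), fed with (D) along the coupling path `t·w ∈ 𝒱(R₀, V₁)` (`inClass_coupling`);
the no-cat slack `δ_v` (`E₀ < ∞` by `periodicGroundStateEnergy_ne_top_of_inClass`); the least weighted-bound slack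
over the finite box containing the window (`inWindow_mem_box`); `δ = min(δ_c, δ_v, δ_W)` and
`cellOccupation_le_of_bootstrap_inputs` mode by mode. [folklore] -/
theorem normalisationBootstrap_of
    (hM : ∀ {n : ℕ} {L : ℝ}, 0 < L → ∀ {k : Fin 3 → ℤ}, k ≠ 0 → ∀ (Ψ : PeriodicTrialState (n + 2) L),
      (n + 2 : ℝ) / 2 < (normSq L (modeAn L (planeWaveMode L 0) Ψ.ψ)).toReal →
        (n + 2 : ℝ) * (normSq L (modeAn L (planeWaveMode L k) Ψ.ψ)).toReal -
            (normSq L (modeAn L (planeWaveMode L k) (modeAn L (planeWaveMode L 0) Ψ.ψ))).toReal ≤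
          (n + 2 : ℝ) / 2 * (normSq L (modeAn L (planeWaveMode L k) Ψ.ψ)).toReal +
            (n + 2 : ℝ) * ((normSq L (modeAn L (planeWaveMode L 0) (modeAn L (planeWaveMode L 0) Ψ.ψ))).toReal +
              (normSq L (modeAn L (planeWaveMode L 0) Ψ.ψ)).toReal -
                (normSq L (modeAn L (planeWaveMode L 0) Ψ.ψ)).toReal ^ 2) /
              ((normSq L (modeAn L (planeWaveMode L 0) Ψ.ψ)).toReal - (n + 2 : ℝ) / 2))
    (hD : ∀ R₀ V₁ : ℝ, 0 < R₀ → 0 ≤ V₁ → CondensateNumberVarianceClass R₀ V₁ → WeightedClassBound R₀ V₁ →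
      ∃ ρ₁ : ℝ, 0 < ρ₁ ∧ ∀ ρ : ℝ, 0 < ρ → ρ < ρ₁ → ∀ᶠ N : ℕ in atTop, ∀ w : ℝ → ℝ≥0∞, InClass R₀ V₁ w →
        ∃ δ : ℝ≥0∞, 0 < δ ∧ ∀ Ψ : PeriodicTrialState N (sideLength ρ N), NearMin w ρ N δ Ψ →
          (condensateOccupation N (sideLength ρ N) Ψ.ψ).toReal ≤ 3 / 20 * N ∨
            17 / 20 * N ≤ (condensateOccupation N (sideLength ρ N) Ψ.ψ).toReal)
    (hC : ∀ {N : ℕ} {L : ℝ}, 1 ≤ N → 0 < L → ∀ {w : ℝ → ℝ≥0∞}, IsRepulsiveFiniteRange w →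
      (∫⁻ x : Space, w ‖x‖) ≠ ⊤ → ∀ {a b : ℝ}, a < b → b < 1 →
        (∀ t : ℝ, t ∈ Set.Icc (0 : ℝ) 1 → ∃ δ : ℝ≥0∞, 0 < δ ∧ ∀ Ψ : PeriodicTrialState N L,
          periodicEnergy (fun r => ENNReal.ofReal t * w r) Ψ ≤
              periodicGroundStateEnergy (fun r => ENNReal.ofReal t * w r) N L + δ →
            (condensateOccupation N L Ψ.ψ).toReal ≤ a * N ∨ b * N ≤ (condensateOccupation N L Ψ.ψ).toReal) →
        ∃ δ : ℝ≥0∞, 0 < δ ∧ ∀ Ψ : PeriodicTrialState N L,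
          periodicEnergy w Ψ ≤ periodicGroundStateEnergy w N L + δ →
            b * N ≤ (condensateOccupation N L Ψ.ψ).toReal) :
    NormalisationBootstrap := by
  intro R₀ V₁ hR₀ hV₁ NC WB w hw κ hκ
  obtain ⟨ρ₁, hρ₁, HD⟩ := hD R₀ V₁ hR₀ hV₁ NC WB
  obtain ⟨ρv, hρv, CV, hCV, HV⟩ := NC
  obtain ⟨ρw, hρw, C, hC0, HW⟩ := WB κ hκ
  have hCpos : 0 < C + 6 * CV * κ := by positivity
  refine ⟨min ρv (min ρw ρ₁), lt_min hρv (lt_min hρw hρ₁), C + 6 * CV * κ, hCpos, fun ρ hρ hρlt => ?_⟩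
  have hρ_v : ρ < ρv := hρlt.trans_le (min_le_left _ _)
  have hρ_w : ρ < ρw := hρlt.trans_le ((min_le_right _ _).trans (min_le_left _ _))
  have hρ_1 : ρ < ρ₁ := hρlt.trans_le ((min_le_right _ _).trans (min_le_right _ _))
  filter_upwards [HV ρ hρ hρ_v, HW ρ hρ hρ_w, HD ρ hρ hρ_1, eventually_ge_atTop 2] with N HVN HWN HDN hN2
  obtain ⟨n, rfl⟩ : ∃ n, N = n + 2 := ⟨N - 2, by omega⟩
  have hL : 0 < sideLength ρ (n + 2) := sideLength_pos_of_pos hρ (by omega)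
  have hE : periodicGroundStateEnergy w (n + 2) (sideLength ρ (n + 2)) ≠ ⊤ :=
    periodicGroundStateEnergy_ne_top_of_inClass hw n hL
  have hwfr : IsRepulsiveFiniteRange w := ⟨hw.1, R₀, hw.2.1⟩
  have hwint : (∫⁻ x : Space, w ‖x‖) ≠ ⊤ := ne_top_of_le_ne_top ENNReal.ofReal_ne_top hw.2.2
  -- (i) condensation of the near-minimisers of `w`: (D) along the coupling path, then (C)
  obtain ⟨δc, hδc, Hc⟩ := hC (show 1 ≤ n + 2 by omega) hL hwfr hwint
    (show (3 : ℝ) / 20 < 17 / 20 by norm_num) (show (17 : ℝ) / 20 < 1 by norm_num)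
    fun t ht => HDN _ (inClass_coupling hw ht)
  -- (ii) the no-cat slack
  obtain ⟨δv, hδv, Hv⟩ := HVN w hw hE
  -- (iii) the least weighted-bound slack over the finite box containing the window
  have hk : ∀ k : Fin 3 → ℤ, ∃ δ : ℝ≥0∞, 0 < δ ∧ (InWindow κ ρ (n + 2) k →
      ∀ Ψ : PeriodicTrialState (n + 2) (sideLength ρ (n + 2)), NearMin w ρ (n + 2) δ Ψ →
        (normSq (sideLength ρ (n + 2)) (phaseUp (sideLength ρ (n + 2)) k Ψ.ψ)).toReal +
            (normSq (sideLength ρ (n + 2)) (condUp (sideLength ρ (n + 2)) k Ψ.ψ)).toReal ≤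
          C * (n + 2 : ℕ) * Real.sqrt ρ * sideLength ρ (n + 2) / ‖(fun j => (k j : ℝ))‖) := by
    intro k
    by_cases hkw : InWindow κ ρ (n + 2) k
    · obtain ⟨δ, hδ, h⟩ := HWN w hw hE k hkw
      exact ⟨δ, hδ, fun _ => h⟩
    · exact ⟨1, one_pos, fun h' => (hkw h').elim⟩
  choose δf hδf hprop using hk
  set W : Finset (Fin 3 → ℤ) := Fintype.piFinset fun _ : Fin 3 =>
      Finset.Icc (-((⌈κ * Real.sqrt ρ * sideLength ρ (n + 2)⌉₊ : ℕ) : ℤ))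
        ((⌈κ * Real.sqrt ρ * sideLength ρ (n + 2)⌉₊ : ℕ) : ℤ) with hW
  have hW0 : (0 : Fin 3 → ℤ) ∈ W := by
    rw [hW, Fintype.mem_piFinset]
    intro j
    simp
  have hWne : W.Nonempty := ⟨0, hW0⟩
  -- (iv) the slack `δ = min(δ_c, δ_v, δ_W)`
  refine ⟨min δc (min δv (W.inf' hWne δf)),
    lt_min hδc (lt_min hδv ((Finset.lt_inf'_iff hWne).2 fun k _ => hδf k)), fun Ψ hΨ k hkw => ?_⟩
  have hmem : k ∈ W := inWindow_mem_box hkw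
  have hΨc : NearMin w ρ (n + 2) δc Ψ := nearMin_weaken hΨ (min_le_left _ _)
  have hΨv : NearMin w ρ (n + 2) δv Ψ := nearMin_weaken hΨ ((min_le_right _ _).trans (min_le_left _ _))
  have hΨk : NearMin w ρ (n + 2) (δf k) Ψ :=
    nearMin_weaken hΨ ((min_le_right _ _).trans ((min_le_right _ _).trans (Finset.inf'_le _ hmem)))
  rw [irIneq_iff]
  exact cellOccupation_le_of_bootstrap_inputs hM hL hkw.1 Ψ hCV hκ (Real.sqrt_pos.2 hρ) hCpos hkw.2
    (Hc Ψ hΨc) (Hv Ψ hΨv) (hprop k hkw Ψ hΨk)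

/-- **Registered stub `stub_fsumBootstrapAssembly`** (line `fsum-phase-pencil`, S5-A): the normalisation
bootstrap `NormalisationBootstrap` assembled from the moment inequality (M), the dichotomy (D) and the coupling
continuity (C) — `normalisationBootstrap_of`. [folklore] -/
theorem stub_fsumBootstrapAssembly : (∀ {n : ℕ} {L : ℝ}, 0 < L → ∀ {k : Fin 3 → ℤ}, k ≠ 0 → ∀ (Ψ : PeriodicTrialState (n + 2) L), (n + 2 : ℝ) / 2 < (normSq L (modeAn L (planeWaveMode L 0) Ψ.ψ)).toReal → (n + 2 : ℝ) * (normSq L (modeAn L (planeWaveMode L k) Ψ.ψ)).toReal - (normSq L (modeAn L (planeWaveMode L k) (modeAn L (planeWaveMode L 0) Ψ.ψ))).toReal ≤ (n + 2 : ℝ) / 2 * (normSq L (modeAn L (planeWaveMode L k) Ψ.ψ)).toReal + (n + 2 : ℝ) * ((normSq L (modeAn L (planeWaveMode L 0) (modeAn L (planeWaveMode L 0) Ψ.ψ))).toReal + (normSq L (modeAn L (planeWaveMode L 0) Ψ.ψ)).toReal - (normSq L (modeAn L (planeWaveMode L 0) Ψ.ψ)).toReal ^ 2) / ((normSq L (modeAn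 L (planeWaveMode L 0) Ψ.ψ)).toReal - (n + 2 : ℝ) / 2)) → (∀ R₀ V₁ : ℝ, 0 < R₀ → 0 ≤ V₁ → CondensateNumberVarianceClass R₀ V₁ → WeightedClassBound R₀ V₁ → ∃ ρ₁ : ℝ, 0 < ρ₁ ∧ ∀ ρ : ℝ, 0 < ρ → ρ < ρ₁ → ∀ᶠ N : ℕ in atTop, ∀ w : ℝ → ℝ≥0∞, InClass R₀ V₁ w → ∃ δ : ℝ≥0∞, 0 < δ ∧ ∀ Ψ : PeriodicTrialState N (sideLength ρ N), NearMin w ρ N δ Ψ → (condensateOccupation N (sideLength ρ N) Ψ.ψ).toReal ≤ 3 / 20 * N ∨ 17 / 20 * N ≤ (condensateOccupation N (sideLength ρ N) Ψ.ψ).toReal) → (∀ {N : ℕ} {L : ℝ}, 1 ≤ N → 0 < L → ∀ {w : ℝ → ℝ≥0∞}, IsRepulsiveFiniteRange w → (∫⁻ x : Space, w ‖x‖) ≠ ⊤ → ∀ {a b : ℝ}, a < b → b < 1 → (∀ t : ℝ, t ∈ Set.Icc (0 : ℝ) 1 → ∃ δ : ℝ≥0∞, 0 < δ ∧ ∀ Ψ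 : PeriodicTrialState N L, periodicEnergy (fun r => ENNReal.ofReal t * w r) Ψ ≤ periodicGroundStateEnergy (fun r => ENNReal.ofReal t * w r) N L + δ → (condensateOccupation N L Ψ.ψ).toReal ≤ a * N ∨ b * N ≤ (condensateOccupation N L Ψ.ψ).toReal) → ∃ δ : ℝ≥0∞, 0 < δ ∧ ∀ Ψ : PeriodicTrialState N L, periodicEnergy w Ψ ≤ periodicGroundStateEnergy w N L + δ → b * N ≤ (condensateOccupation N L Ψ.ψ).toReal) → NormalisationBootstrap :=
  fun hM hD hC => normalisationBootstrap_of hM hD hC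

end Summit.AtomisticToContinuum.BoseEinsteinCondensation.Cruxes.PeriodicIRBound.FsumPhasePencil

end
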